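import Literature.Analysis.FluidPDE.BilliardTensorTrace
import Summits.AtomisticToContinuum.HydrodynamicLimit.Theorems.JParityClosureAssemblyMomentumModulus

/-!
# Route JParityClosure — `Assembly` (stmt-AtomisticToContinuum-17595): time-modulus of the
# empirical ENERGY field along hard-sphere trajectories — where the missing inputs enter

Energy twin of `JParityClosureAssemblyMomentumModulus.lean`. The fixed-time upgrade
`tendsto_measure_fixedTime_of_timeAverage` needs equicontinuity in probability of
`s ↦ E_N(s) = (N+1)⁻¹ Σᵢ ϑ(xᵢ(s)) |vᵢ(s)|²/2`; unlike density and momentum, NO hypothesis of the item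
(`X = OddContactSymmetry ∧ EvenStressEnskog ∧ RateFloor ∧ LocalSecondLaw ∧ DensityCap`) controls it
(gap G1 of the item's notes: the five statements are time-integrated or density-only, the conclusion
is at a fixed instant). This file proves exactly which two windowed quantities do:

* PATHWISE (`abs_energyObservable_sub_le`; trajectory `γ` on `𝕋ᵈ`, `C¹` scalar field `ϑ` with
  `‖Dϑ‖ ≤ C`, speed level `M ≥ 0`, `a ≤ b`): `|E_ϑ(γ b) − E_ϑ(γ a)| ≤ (b − a)·C·M·E_kin(γ a)
  + C·½ ∫_a^b 𝒯³_M(γ s) ds + C·ε·½ 𝒮ᴱ(a, b]`, with the CUBIC TAIL `𝒯³_M(z) = Σᵢ |vᵢ|³ 1{|vᵢ| > M}`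
  (the streaming energy current above level `M`; the integrand of `EnergyCurrentTails`, stmt-9235)
  and the windowed ENERGY-JUMP functional `𝒮ᴱ(a, b] = Σ_{t_c ∈ (a,b]} Σ_{(i,j) colliding} |Δ|vᵢ|²|/2`
  (`collisionalTransferFunctional` with kernel `(i,j,z⁻,z⁺) ↦ ||vᵢ⁺|² − |vᵢ⁻|²|/2`, the absolute
  collisional energy-transfer mark). Ingredients: the weak energy balance law, the kinetic-flux bound
  `|Σᵢ (Dϑ(xᵢ)vᵢ)|vᵢ|²/2| ≤ C(M·E_kin + ½𝒯³_M)`, the pair form `(ϑ(xᵢ) − ϑ(xⱼ))Δ|vᵢ|²/2` of the jump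
  and the torus mean-value inequality; integrability of `s ↦ 𝒯³_M(γ s)` along a trajectory is
  `IsHardSphereTrajectory.intervalIntegrable_of_continuous_flights` (velocities are constant on flights).
* IN PROBABILITY: the companion file `JParityClosureAssemblyEnergyFixedTime.lean` turns this into the
  `hequi` hypothesis of the upgrade lemma for `E_N`, from tightness of the kinetic energy per particle
  and windowed bounds in probability on `(N+1)⁻¹ ∫_t^{t+Δ} 𝒯³_M` and `(ε_N/(N+1))·½ 𝒮ᴱ(t, t+Δ]` —
  the two inputs the item's `X` lacks (a transient redistribution of kinetic energy by a vanishing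
  fraction of fast particles over a vanishing time window changes no time-integrated collision
  statistic with bounded or relative-speed marks, no time-integrated entropy, no mollified density).
No new objects.
-/

noncomputable section

namespace Summit.AtomisticToContinuum.HydrodynamicLimit.Theorems.JParityClosureEnergyModulus

open Set MeasureTheory Filter Topology Function
open scoped ENNReal InnerProductSpace
open Literature.Analysis.FluidPDE Literature.Analysis.FunctionSpaces
open Literature.MathematicalPhysics.KineticTheory
open Summit.AtomisticToContinuum.HydrodynamicLimit.Theorems.JParityClosureMomentumModulus

variable {d : Type*} [Fintype d]

/-- The elementary split `|v|³ ≤ M |v|² + |v|³ 1{|v| > M}` (`M ≥ 0`). [folklore] -/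
theorem norm_pow_three_le_add_indicator {E : Type*} [SeminormedAddCommGroup E] {M : ℝ} (hM : 0 ≤ M)
    (v : E) : ‖v‖ ^ 3 ≤ M * ‖v‖ ^ 2 + {w : E | M < ‖w‖}.indicator (fun w => ‖w‖ ^ 3) v := by
  by_cases h : M < ‖v‖
  · rw [indicator_of_mem (show v ∈ {w : E | M < ‖w‖} from h)]
    nlinarith [norm_nonneg v, sq_nonneg ‖v‖]
  · rw [indicator_of_notMem (show v ∉ {w : E | M < ‖w‖} from h), add_zero]
    have hv : ‖v‖ ≤ M := not_lt.1 h
    nlinarith [norm_nonneg v, sq_nonneg ‖v‖, mul_le_mul_of_nonneg_right hv (sq_nonneg ‖v‖)]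

/-- **Kinetic energy-flux bound**: `|Σᵢ (Dϑ(xᵢ) vᵢ) |vᵢ|²/2| ≤ C (M · E_kin + ½ 𝒯³_M)` for
`‖Dϑ‖ ≤ C`, `C, M ≥ 0`. [folklore] -/
theorem abs_energyStreaming_le {N : ℕ} {ϑ : UnitAddTorus d → ℝ} {C : ℝ}
    (hC : ∀ x, ‖Torus.fderiv ϑ x‖ ≤ C) {M : ℝ} (hM : 0 ≤ M)
    (z : Config N d (UnitAddTorus d)) :
    |energyStreaming ϑ z| ≤ C * (M * configEnergy z +
      2⁻¹ * ∑ i, {w : EuclideanSpace ℝ d | M < ‖w‖}.indicator (fun w => ‖w‖ ^ 3) (z i).2) := by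
  have key : ∀ i, |Torus.fderiv ϑ (z i).1 (z i).2 * (‖(z i).2‖ ^ 2 / 2)| ≤
      C * (M * (2⁻¹ * ‖(z i).2‖ ^ 2) +
        2⁻¹ * {w : EuclideanSpace ℝ d | M < ‖w‖}.indicator (fun w => ‖w‖ ^ 3) (z i).2) := by
    intro i
    have h1 : |Torus.fderiv ϑ (z i).1 (z i).2| ≤ C * ‖(z i).2‖ := by
      rw [← Real.norm_eq_abs]
      exact (ContinuousLinearMap.le_opNorm _ _).trans
        (mul_le_mul_of_nonneg_right (hC _) (norm_nonneg _))
    have hC0 : 0 ≤ C := le_trans (norm_nonneg _) (hC (z i).1)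
    have h3 := norm_pow_three_le_add_indicator hM (z i).2
    calc |Torus.fderiv ϑ (z i).1 (z i).2 * (‖(z i).2‖ ^ 2 / 2)|
        = |Torus.fderiv ϑ (z i).1 (z i).2| * (‖(z i).2‖ ^ 2 / 2) := by
          rw [abs_mul, abs_of_nonneg (by positivity : (0 : ℝ) ≤ ‖(z i).2‖ ^ 2 / 2)]
      _ ≤ C * ‖(z i).2‖ * (‖(z i).2‖ ^ 2 / 2) := mul_le_mul_of_nonneg_right h1 (by positivity)
      _ = C * (2⁻¹ * ‖(z i).2‖ ^ 3) := by ring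
      _ ≤ C * (2⁻¹ * (M * ‖(z i).2‖ ^ 2 +
            {w : EuclideanSpace ℝ d | M < ‖w‖}.indicator (fun w => ‖w‖ ^ 3) (z i).2)) := by
          gcongr
      _ = _ := by ring
  unfold energyStreaming
  calc |∑ i, Torus.fderiv ϑ (z i).1 (z i).2 * (‖(z i).2‖ ^ 2 / 2)|
      ≤ ∑ i, |Torus.fderiv ϑ (z i).1 (z i).2 * (‖(z i).2‖ ^ 2 / 2)| := Finset.abs_sum_le_sum_abs _ _
    _ ≤ ∑ i, C * (M * (2⁻¹ * ‖(z i).2‖ ^ 2) +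
        2⁻¹ * {w : EuclideanSpace ℝ d | M < ‖w‖}.indicator (fun w => ‖w‖ ^ 3) (z i).2) :=
        Finset.sum_le_sum fun i _ => key i
    _ = _ := by
        simp only [configEnergy, mul_add, Finset.sum_add_distrib, Finset.mul_sum]

/-- **The collisional energy transfer is dominated by the energy-jump functional**: along a
hard-sphere trajectory on `𝕋ᵈ`, for `|ϑ x − ϑ y| ≤ L |x − y|_𝕋`, the transfer over `(a, b]` (sum of the
jumps `(ϑ(xᵢ) − ϑ(xⱼ)) Δ|vᵢ|²/2`, `|xᵢ − xⱼ|_𝕋 = ε`) is at most `L · ε · ½ 𝒮ᴱ(a, b]` (both orientations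
of the colliding pair carry `|Δ|vᵢ|²| = |Δ|vⱼ|²|`). [folklore] -/
theorem abs_energyTransfer_le {ε : ℝ} {N : ℕ} {γ : ℝ → Config N d (UnitAddTorus d)}
    (h : IsHardSphereTrajectory (Torus.geometry d) ε N γ) {ϑ : UnitAddTorus d → ℝ} {L : ℝ}
    (hL : ∀ x y, ‖ϑ x - ϑ y‖ ≤ L * ‖(Torus.geometry d).sepVec x y‖) (a b : ℝ) :
    |collisionalTransfer (Torus.geometry d) ε (energyObservable ϑ) γ a b| ≤
      L * ε * (2⁻¹ * collisionalTransferFunctional (Torus.geometry d) ε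
        (fun i _ pre post => |‖(post i).2‖ ^ 2 - ‖(pre i).2‖ ^ 2| / 2) γ a b) := by
  have hG : ∀ x : UnitAddTorus d, Continuous ((Torus.geometry d).translate x) := fun x =>
    continuous_const.add Torus.continuous_proj
  have hfin := h.finite_collisionTimes_inter_Ioc a b
  rw [collisionalTransfer_eq_sum _ hfin, collisionalTransferFunctional_eq_sum _ hfin,
    Finset.mul_sum, Finset.mul_sum]
  refine (Finset.abs_sum_le_sum_abs _ _).trans (Finset.sum_le_sum fun t ht => ?_)
  obtain ⟨i, j, hij, hc⟩ := mem_collisionTimes.1 (hfin.mem_toFinset.1 ht).1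
  rw [h.sum_collidingPairs_eq hij hc, h.collisionJump_energyObservable hG ϑ hij hc]
  have hvj : |‖(γ t j).2‖ ^ 2 - ‖(leftLim γ t j).2‖ ^ 2| =
      |‖(γ t i).2‖ ^ 2 - ‖(leftLim γ t i).2‖ ^ 2| := by
    rw [show ‖(γ t j).2‖ ^ 2 - ‖(leftLim γ t j).2‖ ^ 2 =
      -(‖(γ t i).2‖ ^ 2 - ‖(leftLim γ t i).2‖ ^ 2) by
        linarith [h.norm_sq_vel_add_eq_leftLim hij hc], abs_neg]
  have hε : ‖(Torus.geometry d).sepVec (γ t i).1 (γ t j).1‖ = ε := (mem_contactSet.1 hc).2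
  rw [hvj, abs_mul, abs_div, abs_two]
  calc |ϑ (γ t i).1 - ϑ (γ t j).1| * (|‖(γ t i).2‖ ^ 2 - ‖(leftLim γ t i).2‖ ^ 2| / 2)
      ≤ L * ε * (|‖(γ t i).2‖ ^ 2 - ‖(leftLim γ t i).2‖ ^ 2| / 2) := by
        refine mul_le_mul_of_nonneg_right ?_ (by positivity)
        rw [← hε, ← Real.norm_eq_abs]
        exact hL _ _
    _ = _ := by ring

/-- Along a hard-sphere trajectory the cubic tail `s ↦ 𝒯³_M(γ s)` (indeed any function of the
velocities alone) is interval integrable: it is constant on free flights. [folklore] -/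
theorem intervalIntegrable_cubicTail {X : Type*} [TopologicalSpace X] {G : Geometry d X} {ε : ℝ}
    {N : ℕ} {γ : ℝ → Config N d X} (h : IsHardSphereTrajectory G ε N γ) (M : ℝ) {a b : ℝ}
    (hab : a ≤ b) :
    IntervalIntegrable (fun s => ∑ i, {w : EuclideanSpace ℝ d | M < ‖w‖}.indicator
      (fun w => ‖w‖ ^ 3) (γ s i).2) volume a b :=
  h.intervalIntegrable_of_continuous_flights
    (Φ := fun _ z => ∑ i, {w : EuclideanSpace ℝ d | M < ‖w‖}.indicator (fun w => ‖w‖ ^ 3) (z i).2)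
    (fun z t₀ => by simp only [freeFlight_apply]; exact continuous_const) hab

/-- **Time-modulus of the energy observable along a hard-sphere trajectory** (`𝕋ᵈ`, `C¹` field `ϑ`,
`‖Dϑ‖ ≤ C`, level `M ≥ 0`, `a ≤ b`):
`|E_ϑ(γ b) − E_ϑ(γ a)| ≤ (b − a)·C·M·E_kin(γ a) + C·½ ∫_a^b 𝒯³_M(γ s) ds + C·ε·½ 𝒮ᴱ(a, b]`
(weak energy balance law + kinetic-flux bound with conservation of `E_kin` + `abs_energyTransfer_le`
with the mean-value inequality). [folklore] -/
theorem abs_energyObservable_sub_le {ε : ℝ} {N : ℕ} {γ : ℝ → Config N d (UnitAddTorus d)}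
    (h : IsHardSphereTrajectory (Torus.geometry d) ε N γ)
    {ϑ : UnitAddTorus d → ℝ} (hϑ : Torus.IsContDiff 1 ϑ) {C : ℝ}
    (hC : ∀ x, ‖Torus.fderiv ϑ x‖ ≤ C) {M : ℝ} (hM : 0 ≤ M) {a b : ℝ} (hab : a ≤ b) :
    |energyObservable ϑ (γ b) - energyObservable ϑ (γ a)| ≤
      (b - a) * (C * (M * configEnergy (γ a))) +
        C * (2⁻¹ * ∫ s in a..b, ∑ i, {w : EuclideanSpace ℝ d | M < ‖w‖}.indicator
          (fun w => ‖w‖ ^ 3) (γ s i).2) +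
        C * ε * (2⁻¹ * collisionalTransferFunctional (Torus.geometry d) ε
          (fun i _ pre post => |‖(post i).2‖ ^ 2 - ‖(pre i).2‖ ^ 2| / 2) γ a b) := by
  have hG : ∀ x : UnitAddTorus d, Continuous ((Torus.geometry d).translate x) := fun x =>
    continuous_const.add Torus.continuous_proj
  obtain ⟨hint, heq⟩ := h.sub_eq_integral_add_collisionalTransfer hG
    (hasDerivAt_energyObservable_freeFlight hϑ)
    (fun z => (continuous_energyStreaming hϑ).comp
      (continuous_freeFlight_of_continuous_translate hG z)) hab
  rw [heq]
  refine (abs_add_le _ _).trans (add_le_add ?_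
    (abs_energyTransfer_le h (norm_sub_le_of_fderiv_le hϑ hC) a b))
  set T : Config N d (UnitAddTorus d) → ℝ := fun z =>
    ∑ i, {w : EuclideanSpace ℝ d | M < ‖w‖}.indicator (fun w => ‖w‖ ^ 3) (z i).2 with hT
  have hTint : IntervalIntegrable (fun s => T (γ s)) volume a b :=
    intervalIntegrable_cubicTail h M hab
  have hmaj : IntervalIntegrable (fun s => C * (M * configEnergy (γ a)) + C * (2⁻¹ * T (γ s)))
      volume a b :=
    intervalIntegrable_const.add ((hTint.const_mul 2⁻¹).const_mul C)
  calc |∫ s in a..b, energyStreaming ϑ (γ s)|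
      ≤ ∫ s in a..b, |energyStreaming ϑ (γ s)| :=
        intervalIntegral.abs_integral_le_integral_abs hab
    _ ≤ ∫ s in a..b, (C * (M * configEnergy (γ a)) + C * (2⁻¹ * T (γ s))) := by
        refine intervalIntegral.integral_mono_on hab hint.abs hmaj fun s _ => ?_
        rw [IsHardSphereTrajectory.configEnergy_eq_holds h a s, ← mul_add]
        exact abs_energyStreaming_le hC hM (γ s)
    _ = (b - a) * (C * (M * configEnergy (γ a))) + C * (2⁻¹ * ∫ s in a..b, T (γ s)) := by
        rw [intervalIntegral.integral_add intervalIntegrable_const ((hTint.const_mul 2⁻¹).const_mul C),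
          intervalIntegral.integral_const, intervalIntegral.integral_const_mul,
          intervalIntegral.integral_const_mul, smul_eq_mul]

/-- **Time-modulus of the energy observable along a hard-sphere flow** (good datum, `t ≤ s`, energy
read at time `0`). [folklore] -/
theorem abs_energyObservable_flow_sub_le {ε : ℝ} {N : ℕ}
    (Φ : HardSphereFlow (Torus.geometry d) ε N) {z : Config N d (UnitAddTorus d)} (hz : z ∈ Φ.good)
    {ϑ : UnitAddTorus d → ℝ} (hϑ : Torus.IsContDiff 1 ϑ) {C : ℝ}
    (hC : ∀ x, ‖Torus.fderiv ϑ x‖ ≤ C) {M : ℝ} (hM : 0 ≤ M) {t s : ℝ} (hts : t ≤ s) :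
    |energyObservable ϑ (Φ.flow s z) - energyObservable ϑ (Φ.flow t z)| ≤
      (s - t) * (C * (M * configEnergy z)) +
        C * (2⁻¹ * ∫ r in t..s, ∑ i, {w : EuclideanSpace ℝ d | M < ‖w‖}.indicator
          (fun w => ‖w‖ ^ 3) (Φ.flow r z i).2) +
        C * ε * (2⁻¹ * collisionalTransferFunctional (Torus.geometry d) ε
          (fun i _ pre post => |‖(post i).2‖ ^ 2 - ‖(pre i).2‖ ^ 2| / 2)
            (fun r => Φ.flow r z) t s) := by
  have htraj := Φ.isTrajectory z hz
  have key := abs_energyObservable_sub_le htraj hϑ hC hM hts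
  have hE : configEnergy (Φ.flow t z) = configEnergy z := by
    rw [IsHardSphereTrajectory.configEnergy_eq_holds htraj t 0]
    exact congrArg configEnergy (Φ.flow_zero z hz)
  rwa [hE] at key

end Summit.AtomisticToContinuum.HydrodynamicLimit.Theorems.JParityClosureEnergyModulus

end
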